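import Mathlib
import Summits.KontsevichZagierPeriods.KontsevichZagierPeriods.Theses.InverseLandau

/-!
# `TateLifting`, line `Sketch`, stub `stub_torusFibre` — a multiplicative relation is a generic fibre

Crux stmt-KontsevichZagierPeriods-9129 (`Summit.KontsevichZagierPeriods.KontsevichZagierPeriods.Theses.InverseLandau.TateLifting`),
weight-one sector. For positive real algebraic `α₁..α_s` with an integer multiplicative relation
`Π αᵢ^{vᵢ} = 1` and an algebraic scalar `λ`, the honest representation
`[(0,1), λ Σᵢ vᵢ (αᵢ − 1)/(1 + (αᵢ − 1) z₀)]` (value `λ Σ vᵢ log αᵢ = 0`) is a GENERIC FIBRE: it is the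
specialisation at an algebraic point of the `(s+1)`-parameter rational family
`F(z₀; u) = u_s · Σᵢ vᵢ (xᵢ(u) − 1)/(1 + (xᵢ(u) − 1) z₀)`, where `x(u)` is the MONOMIAL
parametrisation of the relation torus `{x : Π xᵢ^{vᵢ} = 1}` through the corner `x(0) = 1`:
with `i₀` an index where `e = v_{i₀} ≠ 0` (if `v = 0` the integrand vanishes and the zero family
does it), `xᵢ(u) = Π_j (1 + u_j)^{M i j}` for the integer matrix `M = e·𝟙 − δ_{i₀} ⊗ v`
(so `xᵢ(u) = (1 + uᵢ)^e` for `i ≠ i₀` and `x_{i₀}(u) = Π_{j ≠ i₀} (1 + u_j)^{−v_j}`), for which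
`vᵀ M = 0`, whence `Σ vᵢ log xᵢ(u) ≡ 0` on `U = {u : 1 + u_j > 0 (j < s)}` (open, convex, `∋ 0`);
clearing the monomial denominators `xᵢ = Nᵢ/Dᵢ` (`Nᵢ = Π (1+u_j)^{(M i j)⁺}`,
`Dᵢ = Π (1+u_j)^{(M i j)⁻}`) gives `P/Q ∈ ℚ(z₀, u)` with `Q = Πᵢ ((1 − z₀) Dᵢ + z₀ Nᵢ)`,
`Q(z₀; 0) = 1` (Tate corner) and `Q > 0` on `[0,1] × U`; the algebraic point is
`u_j = α_j^{1/e} − 1` (`j < s`), `u_s = λ`, at which `x(u) = α` because of the relation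
(checked on logarithms: `Σ_j M i j · e⁻¹ log α_j = log αᵢ` as `Σ v_j log α_j = 0`).
The value of each unfolded logarithm is the hypothesis (stub `stub_logIntegral`).
-/

noncomputable section

namespace Summit.KontsevichZagierPeriods.InverseLandau

open Literature.NumberTheory.Transcendental MeasureTheory

/-! ### Elementary real-variable facts -/

/-- A convex combination `(1 - t) D + t N` of two positive reals is positive (`t ∈ [0,1]`).
[folklore] -/
theorem torusFibre_convexComb_pos {D N t : ℝ} (hD : 0 < D) (hN : 0 < N) (ht0 : 0 ≤ t)
    (ht1 : t ≤ 1) : 0 < (1 - t) * D + t * N := by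
  rcases le_total N D with h | h
  · nlinarith [mul_nonneg (sub_nonneg.2 ht1) (sub_nonneg.2 h)]
  · nlinarith [mul_nonneg ht0 (sub_nonneg.2 h)]

/-- Clearing the monomial denominator `D` in `(x - 1)/(1 + (x - 1) t)` for `x = N / D`.
[folklore] -/
theorem torusFibre_frac_eq {N D : ℝ} (t : ℝ) (hD : D ≠ 0) :
    (N - D) / ((1 - t) * D + t * N) = (N / D - 1) / (1 + (N / D - 1) * t) := by
  have h1 : 1 + (N / D - 1) * t = ((1 - t) * D + t * N) / D := by
    field_simp
    ring
  have h2 : N / D - 1 = (N - D) / D := by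
    field_simp
  rw [h1, h2, div_div_div_cancel_right₀ hD]

/-- Partial fractions: `(Σᵢ cᵢ Π_{i' ≠ i} F_{i'}) / Πᵢ Fᵢ = Σᵢ cᵢ / Fᵢ` when no `Fᵢ` vanishes.
[folklore] -/
theorem torusFibre_sum_prod_erase_div {ι : Type*} [Fintype ι] [DecidableEq ι] (c F : ι → ℝ)
    (hF : ∀ i, F i ≠ 0) :
    (∑ i, c i * ∏ i' ∈ Finset.univ.erase i, F i') / ∏ i, F i = ∑ i, c i / F i := by
  rw [Finset.sum_div]
  refine Finset.sum_congr rfl fun i _ => ?_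
  rw [← Finset.mul_prod_erase Finset.univ F (Finset.mem_univ i),
    mul_div_mul_right _ _ (Finset.prod_ne_zero_iff.2 fun i' _ => hF i')]

/-- The specialised family, after clearing denominators, is
`u_s Σᵢ cᵢ (xᵢ - 1)/(1 + (xᵢ - 1) t)` with `xᵢ = Nᵢ / Dᵢ` (`t ∈ [0,1]`, `Nᵢ, Dᵢ > 0`). [folklore] -/
theorem torusFibre_PQ_div {ι : Type*} [Fintype ι] [DecidableEq ι] (N D c : ι → ℝ) (us t : ℝ)
    (hN : ∀ i, 0 < N i) (hD : ∀ i, 0 < D i) (ht0 : 0 ≤ t) (ht1 : t ≤ 1) :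
    us * (∑ i, c i * (N i - D i) *
        ∏ i' ∈ Finset.univ.erase i, ((1 - t) * D i' + t * N i')) /
        ∏ i, ((1 - t) * D i + t * N i) =
      us * ∑ i, c i * ((N i / D i - 1) / (1 + (N i / D i - 1) * t)) := by
  have hF : ∀ i, (1 - t) * D i + t * N i ≠ 0 := fun i =>
    (torusFibre_convexComb_pos (hD i) (hN i) ht0 ht1).ne'
  rw [mul_div_assoc, torusFibre_sum_prod_erase_div _ _ hF]
  congr 1
  refine Finset.sum_congr rfl fun i _ => ?_
  rw [mul_div_assoc, torusFibre_frac_eq t (hD i).ne']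

/-! ### The rational family of the monomial parametrisation -/

/-- The rational family `P/Q ∈ ℚ(z₀, u₀, …, u_s)` of the monomial parametrisation with exponent
matrix `M`: `Q = Πᵢ ((1 − z₀) Dᵢ + z₀ Nᵢ)`, `P = u_s Σᵢ vᵢ (Nᵢ − Dᵢ) Π_{i' ≠ i} ((1 − z₀) D_{i'} + z₀ N_{i'})`
with `Nᵢ = Π_j (1 + u_j)^{(M i j)⁺}`, `Dᵢ = Π_j (1 + u_j)^{(M i j)⁻}`, together with its real
evaluations. [folklore] -/
theorem torusFibre_exists_PQ (s : ℕ) (M : Fin s → Fin s → ℤ) (v : Fin s → ℤ) :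
    ∃ P Q : MvPolynomial (Fin (1 + (s + 1))) ℚ, ∀ (z : Fin 1 → ℝ) (u : Fin (s + 1) → ℝ),
      MvPolynomial.aeval (Fin.append z u) Q =
          ∏ i, ((1 - z 0) * ∏ j, (1 + u (Fin.castSucc j)) ^ (-M i j).toNat +
            z 0 * ∏ j, (1 + u (Fin.castSucc j)) ^ (M i j).toNat) ∧
      MvPolynomial.aeval (Fin.append z u) P =
          u (Fin.last s) * ∑ i, (v i : ℝ) *
            ((∏ j, (1 + u (Fin.castSucc j)) ^ (M i j).toNat) -
              ∏ j, (1 + u (Fin.castSucc j)) ^ (-M i j).toNat) *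
            ∏ i' ∈ Finset.univ.erase i,
              ((1 - z 0) * ∏ j, (1 + u (Fin.castSucc j)) ^ (-M i' j).toNat +
                z 0 * ∏ j, (1 + u (Fin.castSucc j)) ^ (M i' j).toNat) := by
  let W : Fin s → MvPolynomial (Fin (1 + (s + 1))) ℚ := fun j =>
    1 + MvPolynomial.X (Fin.natAdd 1 (Fin.castSucc j))
  let Z : MvPolynomial (Fin (1 + (s + 1))) ℚ := MvPolynomial.X (Fin.castAdd (s + 1) 0)
  let F : Fin s → MvPolynomial (Fin (1 + (s + 1))) ℚ := fun i =>
    (1 - Z) * ∏ j, W j ^ (-M i j).toNat + Z * ∏ j, W j ^ (M i j).toNat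
  refine ⟨MvPolynomial.X (Fin.natAdd 1 (Fin.last s)) *
      ∑ i, (v i : MvPolynomial (Fin (1 + (s + 1))) ℚ) *
        ((∏ j, W j ^ (M i j).toNat) - ∏ j, W j ^ (-M i j).toNat) *
        ∏ i' ∈ Finset.univ.erase i, F i',
    ∏ i, F i, fun z u => ⟨?_, ?_⟩⟩
  · simp only [F, W, Z, map_prod, map_add, map_mul, map_sub, map_one, map_pow,
      MvPolynomial.aeval_X, Fin.append_left, Fin.append_right]
  · simp only [F, W, Z, map_mul, map_sum, map_prod, map_add, map_sub, map_one, map_pow,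
      map_intCast, MvPolynomial.aeval_X, Fin.append_left, Fin.append_right]

/-! ### Logarithms along the torus -/

/-- `log (Nᵢ/Dᵢ) = Σ_j M i j · log w_j` for positive `w`. [folklore] -/
theorem torusFibre_log_div {s : ℕ} (w : Fin s → ℝ) (hw : ∀ j, 0 < w j) (m : Fin s → ℤ) :
    Real.log ((∏ j, w j ^ (m j).toNat) / ∏ j, w j ^ (-m j).toNat) =
      ∑ j, (m j : ℝ) * Real.log (w j) := by
  have hne : ∀ (n : Fin s → ℕ), ∀ j ∈ Finset.univ, w j ^ n j ≠ 0 := fun n j _ =>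
    pow_ne_zero _ (hw j).ne'
  rw [Real.log_div (Finset.prod_ne_zero_iff.2 (hne _)) (Finset.prod_ne_zero_iff.2 (hne _)),
    Real.log_prod (hne _), Real.log_prod (hne _), ← Finset.sum_sub_distrib]
  refine Finset.sum_congr rfl fun j _ => ?_
  rw [Real.log_pow, Real.log_pow, ← sub_mul]
  congr 1
  have h := congrArg (Int.cast (R := ℝ)) (Int.toNat_sub_toNat_neg (m j))
  push_cast at h
  exact h

/-- `vᵀ M = 0` for `M = e·𝟙 − δ_{i₀} ⊗ v`, `e = v_{i₀}`. [folklore] -/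
theorem torusFibre_sum_v_mul_M {s : ℕ} (v : Fin s → ℤ) (i₀ j : Fin s) :
    ∑ i, (v i : ℝ) * (((if j = i then v i₀ else 0) - (if i = i₀ then v j else 0) : ℤ) : ℝ) =
      0 := by
  simp [mul_sub, Finset.sum_sub_distrib, mul_comm]

/-- `Σ_j M i j · ℓ_j = e ℓᵢ` for `M = e·𝟙 − δ_{i₀} ⊗ v` whenever `Σ_j v_j ℓ_j = 0`. [folklore] -/
theorem torusFibre_sum_M_mul {s : ℕ} (v : Fin s → ℤ) (i₀ i : Fin s) (ℓ : Fin s → ℝ)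
    (hℓ : ∑ j, (v j : ℝ) * ℓ j = 0) :
    ∑ j, (((if j = i then v i₀ else 0) - (if i = i₀ then v j else 0) : ℤ) : ℝ) * ℓ j =
      (v i₀ : ℝ) * ℓ i := by
  by_cases hi : i = i₀
  · subst hi
    simp [sub_mul, Finset.sum_sub_distrib, hℓ]
  · simp [hi]

/-- Log cancellation along the torus: `Σᵢ vᵢ Σ_j M i j · L_j = 0`. [folklore] -/
theorem torusFibre_log_cancel {s : ℕ} (v : Fin s → ℤ) (i₀ : Fin s) (M : Fin s → Fin s → ℤ)
    (hM : ∀ i j, M i j = (if j = i then v i₀ else 0) - (if i = i₀ then v j else 0))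
    (L : Fin s → ℝ) : ∑ i, (v i : ℝ) * ∑ j, (M i j : ℝ) * L j = 0 := by
  simp_rw [Finset.mul_sum, ← mul_assoc]
  rw [Finset.sum_comm]
  simp_rw [← Finset.sum_mul, hM, torusFibre_sum_v_mul_M, zero_mul, Finset.sum_const_zero]

/-! ### Roots of positive algebraic numbers -/

/-- If `y ^ e` is algebraic for some nonzero integer `e`, then so is `y`. [folklore] -/
theorem torusFibre_isAlgebraic_of_zpow {y : ℝ} {e : ℤ} (he : e ≠ 0)
    (h : IsAlgebraic ℚ (y ^ e)) : IsAlgebraic ℚ y := by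
  obtain ⟨n, rfl | rfl⟩ := Int.eq_nat_or_neg e
  · exact IsAlgebraic.of_pow (n := n) (by omega) (by simpa using h)
  · rw [zpow_neg, zpow_natCast, IsAlgebraic.inv_iff] at h
    exact IsAlgebraic.of_pow (n := n) (by omega) h

/-- `(y^{1/e})^e = y` for `y > 0` and a nonzero integer `e`. [folklore] -/
theorem torusFibre_rpow_inv_zpow {y : ℝ} (hy : 0 < y) {e : ℤ} (he : e ≠ 0) :
    (y ^ (e : ℝ)⁻¹) ^ e = y := by
  rw [← Real.rpow_intCast, ← Real.rpow_mul hy.le, inv_mul_cancel₀ (Int.cast_ne_zero.2 he),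
    Real.rpow_one]

/-! ### The cube integral of the family -/

/-- Given the log unfolding, `∫_{(0,1)} b Σᵢ cᵢ (xᵢ−1)/(1+(xᵢ−1)z₀) dz₀ = b Σᵢ cᵢ log xᵢ` for
positive `xᵢ`. [folklore] -/
theorem torusFibre_integral_sum
    (hL : ∀ x : ℝ, 0 < x →
      ∫ z in Set.pi Set.univ (fun _ : Fin 1 => Set.Ioo (0 : ℝ) 1),
        (x - 1) / (1 + (x - 1) * z 0) = Real.log x)
    {ι : Type*} [Fintype ι] (x : ι → ℝ) (hx : ∀ i, 0 < x i) (c : ι → ℝ) (b : ℝ) :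
    ∫ z in Set.pi Set.univ (fun _ : Fin 1 => Set.Ioo (0 : ℝ) 1),
        b * ∑ i, c i * ((x i - 1) / (1 + (x i - 1) * z 0)) = b * ∑ i, c i * Real.log (x i) := by
  have hint : ∀ i, Integrable (fun z : Fin 1 → ℝ => (x i - 1) / (1 + (x i - 1) * z 0))
      (volume.restrict (Set.pi Set.univ fun _ : Fin 1 => Set.Ioo (0 : ℝ) 1)) := by
    intro i
    have hK : IsCompact (Set.pi Set.univ fun _ : Fin 1 => Set.Icc (0 : ℝ) 1) :=
      isCompact_univ_pi fun _ => isCompact_Icc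
    have hc : ContinuousOn (fun z : Fin 1 → ℝ => (x i - 1) / (1 + (x i - 1) * z 0))
        (Set.pi Set.univ fun _ : Fin 1 => Set.Icc (0 : ℝ) 1) := by
      refine continuousOn_const.div (by fun_prop) fun z hz => ?_
      have h0 := Set.mem_univ_pi.1 hz 0
      rw [show (1 : ℝ) + (x i - 1) * z 0 = (1 - z 0) * 1 + z 0 * x i by ring]
      exact (torusFibre_convexComb_pos one_pos (hx i) h0.1 h0.2).ne'
    exact (hc.integrableOn_compact hK).mono_set (Set.pi_mono fun _ _ => Set.Ioo_subset_Icc_self)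
  rw [integral_const_mul, integral_finsetSum _ fun i _ => (hint i).const_mul (c i)]
  congr 1
  exact Finset.sum_congr rfl fun i _ => by rw [integral_const_mul, hL _ (hx i)]

/-- The cube integral of the cleared family is `u_s Σᵢ cᵢ log (Nᵢ/Dᵢ)`. [folklore] -/
theorem torusFibre_integral_PQ
    (hL : ∀ x : ℝ, 0 < x →
      ∫ z in Set.pi Set.univ (fun _ : Fin 1 => Set.Ioo (0 : ℝ) 1),
        (x - 1) / (1 + (x - 1) * z 0) = Real.log x)
    {ι : Type*} [Fintype ι] [DecidableEq ι] (N D c : ι → ℝ) (us : ℝ)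
    (hN : ∀ i, 0 < N i) (hD : ∀ i, 0 < D i) :
    ∫ z in Set.pi Set.univ (fun _ : Fin 1 => Set.Ioo (0 : ℝ) 1),
        us * (∑ i, c i * (N i - D i) *
          ∏ i' ∈ Finset.univ.erase i, ((1 - z 0) * D i' + z 0 * N i')) /
          ∏ i, ((1 - z 0) * D i + z 0 * N i) = us * ∑ i, c i * Real.log (N i / D i) := by
  rw [setIntegral_congr_fun (MeasurableSet.univ_pi fun _ => measurableSet_Ioo)
      (g := fun z : Fin 1 → ℝ => us * ∑ i, c i * ((N i / D i - 1) / (1 + (N i / D i - 1) * z 0)))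
      fun z hz => torusFibre_PQ_div N D c us (z 0) hN hD (Set.mem_univ_pi.1 hz 0).1.le
        (Set.mem_univ_pi.1 hz 0).2.le]
  exact torusFibre_integral_sum hL _ (fun i => div_pos (hN i) (hD i)) c us

/-! ### The torus fibre -/

/-- **Torus fibre** (stub `stub_torusFibre` of line `Sketch` for crux `TateLifting`): given the
log unfolding `∫_{(0,1)} (x−1)/(1+(x−1)z₀) = log x` (hypothesis), the honest representation of
`λ Σ vᵢ (αᵢ−1)/(1+(αᵢ−1)z₀)` over `(0,1)` for a multiplicative relation `Π αᵢ^{vᵢ} = 1` among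
positive real algebraic numbers and algebraic `λ` lies in the set `𝒢` of generic fibres. [folklore] -/
theorem tateLifting_torusFibre :
    (∀ x : ℝ, 0 < x →
      ∫ z in Set.pi Set.univ (fun _ : Fin 1 => Set.Ioo (0 : ℝ) 1),
        (x - 1) / (1 + (x - 1) * z 0) = Real.log x) →
    ∀ (s : ℕ) (α : Fin s → ℝ) (v : Fin s → ℤ) (lam : ℝ) (ρ : KZ.IntegralRep 1),
      (∀ i, 0 < α i) → (∀ i, IsAlgebraic ℚ (α i)) → IsAlgebraic ℚ lam →
      ∏ i, α i ^ (v i) = 1 →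
      ρ.domain = Set.pi Set.univ (fun _ : Fin 1 => Set.Ioo (0 : ℝ) 1) →
      Set.EqOn ρ.integrand
        (fun z => lam * ∑ i, (v i : ℝ) * ((α i - 1) / (1 + (α i - 1) * z 0))) ρ.domain →
      KZ.of ρ ∈
        {d : KZ.FormalRep | ∃ (n k : ℕ) (P Q : MvPolynomial (Fin (n + k)) ℚ) (U : Set (Fin k → ℝ))
            (γ : ℝ → (Fin k → ℝ)) (a : Fin k → ℝ) (r : KZ.IntegralRep n),
          IsOpen U ∧ ContinuousOn γ (Set.Icc 0 1) ∧ γ 0 = 0 ∧ γ 1 = a ∧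
          (∀ t ∈ Set.Icc (0 : ℝ) 1, γ t ∈ U) ∧
          (∃ c₀ : ℚ, c₀ ≠ 0 ∧ ∀ z : Fin n → ℝ,
            MvPolynomial.aeval (Fin.append z (0 : Fin k → ℝ)) Q = (c₀ : ℝ)) ∧
          (∀ (z : Fin n → ℝ) (u : Fin k → ℝ), (∀ i, z i ∈ Set.Icc (0 : ℝ) 1) → u ∈ U →
            MvPolynomial.aeval (Fin.append z u) Q ≠ 0) ∧
          (∀ u ∈ U, ∫ z in Set.pi Set.univ (fun _ : Fin n => Set.Ioo (0 : ℝ) 1),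
            MvPolynomial.aeval (Fin.append z u) P / MvPolynomial.aeval (Fin.append z u) Q = 0) ∧
          (∀ j, IsAlgebraic ℚ (a j)) ∧
          r.domain = Set.pi Set.univ (fun _ : Fin n => Set.Ioo (0 : ℝ) 1) ∧
          Set.EqOn r.integrand (fun z => MvPolynomial.aeval (Fin.append z a) P /
            MvPolynomial.aeval (Fin.append z a) Q) r.domain ∧
          d = KZ.of r} := by
  intro hL s α v lam ρ hα hαa hlam hrel hdom hint
  simp only [Set.mem_setOf_eq]
  by_cases hv : ∃ i₀, v i₀ ≠ 0
  swap
  · -- `v = 0`: the integrand vanishes on the domain; the zero family does it.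
    push Not at hv
    refine ⟨1, 0, 0, 1, Set.univ, fun _ => 0, 0, ρ, isOpen_univ, continuousOn_const, rfl, rfl,
      fun _ _ => Set.mem_univ _, ⟨1, one_ne_zero, fun _ => by simp⟩, fun _ _ _ _ => by simp,
      fun _ _ => by simp, fun j => j.elim0, hdom, fun z hz => ?_, rfl⟩
    dsimp only
    rw [hint hz]
    simp [hv]
  obtain ⟨i₀, he⟩ := hv
  -- the exponent matrix `M = e·𝟙 − δ_{i₀} ⊗ v` of the monomial parametrisation
  obtain ⟨M, hM⟩ : ∃ M : Fin s → Fin s → ℤ,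
      ∀ i j, M i j = (if j = i then v i₀ else 0) - (if i = i₀ then v j else 0) :=
    ⟨_, fun _ _ => rfl⟩
  obtain ⟨P, Q, hPQ⟩ := torusFibre_exists_PQ s M v
  -- the algebraic parameter point
  obtain ⟨a, ha, ha'⟩ : ∃ a : Fin (s + 1) → ℝ,
      (∀ j, a (Fin.castSucc j) = α j ^ (v i₀ : ℝ)⁻¹ - 1) ∧ a (Fin.last s) = lam :=
    ⟨Fin.snoc (α := fun _ => ℝ) (fun j => α j ^ (v i₀ : ℝ)⁻¹ - 1) lam, fun j => by simp, by simp⟩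
  have hUpos : ∀ u : Fin (s + 1) → ℝ, (∀ j, 0 < 1 + u (Fin.castSucc j)) → ∀ i,
      (0 < ∏ j, (1 + u (Fin.castSucc j)) ^ (M i j).toNat) ∧
        0 < ∏ j, (1 + u (Fin.castSucc j)) ^ (-M i j).toNat := fun u hu i =>
    ⟨Finset.prod_pos fun j _ => pow_pos (hu j) _, Finset.prod_pos fun j _ => pow_pos (hu j) _⟩
  have haU : ∀ j, 0 < 1 + a (Fin.castSucc j) := fun j => by
    rw [ha j]
    have := Real.rpow_pos_of_pos (hα j) (v i₀ : ℝ)⁻¹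
    linarith
  have hlogrel : ∑ j, (v j : ℝ) * Real.log (α j) = 0 := by
    have h : Real.log (∏ j, α j ^ v j) = 0 := by rw [hrel, Real.log_one]
    rw [Real.log_prod fun j _ => (zpow_pos (hα j) (v j)).ne'] at h
    simpa only [Real.log_zpow] using h
  -- at the parameter point the monomials take the values `α`
  have hxa : ∀ i, (∏ j, (1 + a (Fin.castSucc j)) ^ (M i j).toNat) /
      ∏ j, (1 + a (Fin.castSucc j)) ^ (-M i j).toNat = α i := by
    intro i
    refine Real.log_injOn_pos (Set.mem_Ioi.2 (div_pos (hUpos a haU i).1 (hUpos a haU i).2))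
      (Set.mem_Ioi.2 (hα i)) ?_
    rw [torusFibre_log_div _ haU]
    simp_rw [ha, add_sub_cancel, Real.log_rpow (hα _), hM]
    have hsum : ∑ j, (v j : ℝ) * ((v i₀ : ℝ)⁻¹ * Real.log (α j)) =
        (v i₀ : ℝ)⁻¹ * ∑ j, (v j : ℝ) * Real.log (α j) := by
      rw [Finset.mul_sum]
      exact Finset.sum_congr rfl fun j _ => by ring
    rw [torusFibre_sum_M_mul v i₀ i _ (by rw [hsum, hlogrel, mul_zero]), ← mul_assoc,
      mul_inv_cancel₀ (Int.cast_ne_zero.2 he), one_mul]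
  refine ⟨1, s + 1, P, Q, {u | ∀ j : Fin s, 0 < 1 + u (Fin.castSucc j)}, fun t => t • a, a, ρ,
    ?_, (by fun_prop : Continuous fun t : ℝ => t • a).continuousOn, zero_smul _ _, one_smul _ _,
    ?_, ⟨1, one_ne_zero, fun z => ?_⟩, ?_, ?_, ?_, hdom, fun z hz => ?_, rfl⟩
  · -- `U` is open
    rw [Set.setOf_forall]
    exact isOpen_iInter_of_finite fun j => isOpen_lt continuous_const (by fun_prop)
  · -- the segment from the corner to `a` stays in `U`
    intro t ht j
    simp only [Pi.smul_apply, smul_eq_mul]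
    rw [ha j, show (1 : ℝ) + t * (α j ^ (v i₀ : ℝ)⁻¹ - 1) = (1 - t) * 1 + t * α j ^ (v i₀ : ℝ)⁻¹
      by ring]
    exact torusFibre_convexComb_pos one_pos (Real.rpow_pos_of_pos (hα j) _) ht.1 ht.2
  · -- Tate corner: `Q(z; 0) = 1`
    rw [(hPQ z 0).1]
    simp
  · -- admissibility: `Q ≠ 0` on `[0,1] × U`
    intro z u hz hu
    have hu' : ∀ j, 0 < 1 + u (Fin.castSucc j) := hu
    rw [(hPQ z u).1]
    exact Finset.prod_ne_zero_iff.2 fun i _ =>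
      (torusFibre_convexComb_pos (hUpos u hu' i).2 (hUpos u hu' i).1 (hz 0).1 (hz 0).2).ne'
  · -- the cube integral vanishes for every parameter in `U`
    intro u hu
    have hu' : ∀ j, 0 < 1 + u (Fin.castSucc j) := hu
    obtain ⟨hQ, hP⟩ := forall_and.1 fun z => hPQ z u
    simp_rw [hQ, hP]
    rw [torusFibre_integral_PQ hL _ _ _ _ (fun i => (hUpos u hu' i).1)
      (fun i => (hUpos u hu' i).2)]
    simp_rw [torusFibre_log_div _ hu']
    rw [torusFibre_log_cancel v i₀ M hM, mul_zero]
  · -- the parameter point is algebraic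
    intro j
    rcases Fin.eq_castSucc_or_eq_last j with ⟨j, rfl⟩ | rfl
    · rw [ha]
      exact (torusFibre_isAlgebraic_of_zpow he
        (by rw [torusFibre_rpow_inv_zpow (hα j) he]; exact hαa j)).sub isAlgebraic_one
    · rw [ha']
      exact hlam
  · -- the fibre over `a` is `ρ`
    dsimp only
    have hz0 : z 0 ∈ Set.Ioo (0 : ℝ) 1 := Set.mem_univ_pi.1 (hdom ▸ hz) 0
    rw [hint hz, (hPQ z a).1, (hPQ z a).2, torusFibre_PQ_div _ _ _ _ _
      (fun i => (hUpos a haU i).1) (fun i => (hUpos a haU i).2) hz0.1.le hz0.2.le]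
    simp_rw [hxa, ha']

end Summit.KontsevichZagierPeriods.InverseLandau

end
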